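import Summits.Ventures.CertifiedManyBodySolver.Rows.RectMarginalNodesSymTransport
import HarnessLib

/-!
# Square-lattice window-marginal nodes — module 9/9: RectMarginalNodesSymTL

HONEST FRAMING: first certified bounds; not a superconductivity verdict; every number certified or labelled float.
SOUNDNESS / TRANSPORT statements only (inequalities between relaxations and finite-torus / thermodynamic-limit energies); no number is certified here.
THIS module: 7.5 the thermodynamic limit `LTIRectSymGSNode.le_energyDensity2D` (+ `rectN_seven_eighths` / `rectN_one`, `M3` / `M2` cells, `LTIRectSymNode.…`) and 7.6 the term-wise versions `LTIRectSymGSNodeTW.le_energyDensity2D` / cells.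

FILING NOTE (sr-mbsolver-lit-4 g9, 2026-08-22): modules 5–9 `Rows/RectMarginalNodesTW.lean` → `…Sym.lean` → `…SymTorus.lean` → `…SymTransport.lean` → `…SymTL.lean`
continue parts 1–4 (`Rows/RectMarginalNodes.lean` … `Rows/RectMarginalNodesGS.lean`) and are sr-mbsolver-op-07 gen-12's PROVED HOME file
`HOME/sr-mbsolver-op-07/lean/RectMarginalNodes_v3.2.lean` (sha256 d4d4026ae96b32c5…, 2 279 lines, sorry-free, standard axioms; = v3.1 87fe4cef… with the §7.4 proof cut into
`IsSymTorusState` / `isSymTorusState_sectorGround` / `le_div_of_isSymTorusState`) §6b–§7 split per op-07's `FILING-MAP-v3.2.md` (one-writer rule; §8 not filed: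
content-duplicate of pub-hubbard #235 `HubbardAlg/GSWindowNodeD4Sound.lean`), namespace `…CertifiedManyBodySolver.Sketch2D` renamed `Summit.Ventures.CertifiedManyBodySolver.Rows.RectMarginalNodes`;
declarations, statements and proofs VERBATIM (9 one-line docstrings added for the gate's lint; modules 8/9 re-declare the §7.3 `variable {L : ℕ} [NeZero L]` and module 8
re-applies module 7's `DecidableEq (FermionTorus 2 L)` instance as a local instance of priority high (op-07 g13 advisories A1/A2 adopted: minimal imports, no pin in module 9).
-/

noncomputable section

open Matrix Complex Finset Filter Topology
open scoped ComplexOrder MatrixOrder BigOperators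
open Literature.Probability.LatticeModels
open Literature.MathematicalPhysics.QuantumLattice
open Literature.MathematicalPhysics.QuantumLattice.AndersonCluster
open Literature.MathematicalPhysics.QuantumLattice.HubbardWave0
open Literature.MathematicalPhysics.QuantumLattice.ThermodynamicLimit
open Literature.MathematicalPhysics.QuantumManyBody.StateRelaxation

namespace Summit.Ventures.CertifiedManyBodySolver.Rows.RectMarginalNodes

section SymTL

variable {L : ℕ} [NeZero L]

/-! ### 7.5  The thermodynamic limit: `LTIRectSymGSNode ⇒ energyDensity2D`, and the `M3` / `M2` cells -/

/-- **SOUNDNESS of the symmetric ground-state-class node in the thermodynamic limit.**  If for some period `c ≥ 1`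
the node holds at the torus densities `N_L(n)/L²` of all large `L ∈ c ℕ`, then `lo ≤ e(t,U,n)`
(`E₀(torus L, N_L(n))/L² → e(n)`, `tendsto_energyDensity2D_torus`, along the subsequence `L = c k`). -/
theorem LTIRectSymGSNode.le_energyDensity2D (t : ℝ) {U : ℝ} (hU : 0 ≤ U) {a b : ℕ} (ha : 2 ≤ a) (hb : 2 ≤ b)
    {n : ℝ} (hn0 : 0 ≤ n) (hn2 : n < 2) {lo : ℝ} {c : ℕ} (hc : 0 < c)
    (h : ∀ L : ℕ, c ∣ L → a + b + 3 ≤ L → LTIRectSymGSNode t U a b ((rectN n L : ℝ) / (L : ℝ) ^ 2) lo) :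
    lo ≤ energyDensity2D t U n := by
  have hck : Tendsto (fun k : ℕ => c * k) atTop atTop :=
    tendsto_atTop_atTop.2 fun N => ⟨N, fun k hk => hk.trans (Nat.le_mul_of_pos_left k hc)⟩
  refine ge_of_tendsto ((tendsto_energyDensity2D_torus t hU hn0 hn2).comp hck) ?_
  filter_upwards [eventually_ge_atTop (a + b + 3)] with k hk
  have hLk : a + b + 3 ≤ c * k := hk.trans (Nat.le_mul_of_pos_left k hc)
  haveI : NeZero (c * k) := ⟨by omega⟩
  rw [Function.comp_apply]
  have hnode := h (c * k) (dvd_mul_right c k) hLk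
  have hle : rectN n (c * k) ≤ 2 * (c * k) ^ 2 := by
    rw [sq]; exact rectN_le_two_mul hn0 hn2.le (c * k)
  exact hnode.le_groundEnergyAt_div t U (by omega) ha hb hLk hle

/-- … and of the symmetric node. -/
theorem LTIRectSymNode.le_energyDensity2D (t : ℝ) {U : ℝ} (hU : 0 ≤ U) {a b : ℕ} (ha : 2 ≤ a) (hb : 2 ≤ b)
    {n : ℝ} (hn0 : 0 ≤ n) (hn2 : n < 2) {lo : ℝ} {c : ℕ} (hc : 0 < c)
    (h : ∀ L : ℕ, c ∣ L → a + b + 3 ≤ L → LTIRectSymNode t U a b ((rectN n L : ℝ) / (L : ℝ) ^ 2) lo) :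
    lo ≤ energyDensity2D t U n :=
  LTIRectSymGSNode.le_energyDensity2D t hU ha hb hn0 hn2 hc fun L h1 h2 => (h L h1 h2).symGSNode

/-- `N_L(7/8) / L² = 7/8` exactly for `L ∈ 4ℕ`, `L ≥ 4`: `N_{4j} = 14 j²`. -/
theorem rectN_seven_eighths (j : ℕ) : rectN (7 / 8) (4 * j) = 14 * j ^ 2 := by
  unfold rectN
  have e : (7 / 8 : ℝ) * ((4 * j : ℕ) : ℝ) ^ 2 / 2 = ((7 * j ^ 2 : ℕ) : ℝ) := by push_cast; ring
  rw [e, Nat.floor_natCast]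
  ring

/-- `N_L(1) / L² = 1` exactly for even `L`: `N_{2j} = 4 j²`. -/
theorem rectN_one (j : ℕ) : rectN 1 (2 * j) = 4 * j ^ 2 := by
  unfold rectN
  have e : (1 : ℝ) * ((2 * j : ℕ) : ℝ) ^ 2 / 2 = ((2 * j ^ 2 : ℕ) : ℝ) := by push_cast; ring
  rw [e, Nat.floor_natCast]
  ring

/-- **Cell M3 at `t' = 0` (the programme's TARGET OF RECORD `U = 8`, `n = 7/8`)**: a certified bound
`LTIRectSymGSNode 1 8 a b (7/8) lo` on any `a × b` rectangle (`a, b ≥ 2`) is an `M3EnergyLowerRow 0 lo` — with the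
D₄-identification, isotropy, spin-flip, `SU(2)`, `U(1)×U(1)` block AND local-stability rows of `tl_marginal2d` /
Form-M now SOUND BY NAME, jointly. -/
theorem LTIRectSymGSNode.m3EnergyLowerRow {a b : ℕ} (ha : 2 ≤ a) (hb : 2 ≤ b) {lo : ℚ}
    (h : LTIRectSymGSNode 1 8 a b (7 / 8) lo) : M3EnergyLowerRow 0 lo := by
  refine (M3EnergyLowerRow_zero_iff lo).2
    (LTIRectSymGSNode.le_energyDensity2D 1 (by norm_num) ha hb (by norm_num) (by norm_num) (c := 4) (by norm_num)
      fun L hL h3 => ?_)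
  obtain ⟨j, rfl⟩ := hL
  have hj : (0 : ℝ) < j := by exact_mod_cast (show 0 < j by omega)
  have e : ((rectN (7 / 8) (4 * j) : ℕ) : ℝ) / ((4 * j : ℕ) : ℝ) ^ 2 = 7 / 8 := by
    rw [rectN_seven_eighths]
    push_cast
    field_simp
    ring
  rw [e]
  exact h

/-- **Cell M2 (half filling)**: `LTIRectSymGSNode 1 U a b 1 lo → M2EnergyLowerRow U lo` (`U ≥ 0`). -/
theorem LTIRectSymGSNode.m2EnergyLowerRow {U : ℝ} (hU : 0 ≤ U) {a b : ℕ} (ha : 2 ≤ a) (hb : 2 ≤ b) {lo : ℚ}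
    (h : LTIRectSymGSNode 1 U a b 1 lo) : M2EnergyLowerRow U lo := by
  refine LTIRectSymGSNode.le_energyDensity2D 1 hU ha hb zero_le_one one_lt_two (c := 2) (by norm_num)
    fun L hL h3 => ?_
  obtain ⟨j, rfl⟩ := hL
  have hj : (0 : ℝ) < j := by exact_mod_cast (show 0 < j by omega)
  have e : ((rectN 1 (2 * j) : ℕ) : ℝ) / ((2 * j : ℕ) : ℝ) ^ 2 = 1 := by
    rw [rectN_one]
    push_cast
    field_simp
    ring
  rw [e]
  exact h

/-- The cells of the symmetric node (no stability rows). -/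
theorem LTIRectSymNode.m3EnergyLowerRow {a b : ℕ} (ha : 2 ≤ a) (hb : 2 ≤ b) {lo : ℚ}
    (h : LTIRectSymNode 1 8 a b (7 / 8) lo) : M3EnergyLowerRow 0 lo :=
  h.symGSNode.m3EnergyLowerRow ha hb

/-- The `M2` cell (half filling) of a certified symmetric node, via its ground-state-class weakening. -/
theorem LTIRectSymNode.m2EnergyLowerRow {U : ℝ} (hU : 0 ≤ U) {a b : ℕ} (ha : 2 ≤ a) (hb : 2 ≤ b) {lo : ℚ}
    (h : LTIRectSymNode 1 U a b 1 lo) : M2EnergyLowerRow U lo :=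
  h.symGSNode.m2EnergyLowerRow hU ha hb

/-- … and through the dropped-rows edges, the §4 and §6 cells factor through §7 (consistency check). -/
example {a b : ℕ} (ha : 2 ≤ a) (hb : 2 ≤ b) {lo : ℚ} (h : LTIRectNode 1 8 a b (7 / 8) lo) : M3EnergyLowerRow 0 lo :=
  h.symNode.m3EnergyLowerRow ha hb

example {a b : ℕ} (ha : 2 ≤ a) (hb : 2 ≤ b) {lo : ℚ} (h : LTIRectGSNode 1 8 a b (7 / 8) lo) : M3EnergyLowerRow 0 lo :=
  h.symGSNode.m3EnergyLowerRow ha hb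

/-! ### 7.6  The term-wise symmetric node in the thermodynamic limit, and its cells -/

/-- **SOUNDNESS of `LTIRectSymGSNodeTW` in the thermodynamic limit** (as `LTIRectSymGSNode.le_energyDensity2D`). -/
theorem LTIRectSymGSNodeTW.le_energyDensity2D (t : ℝ) {U : ℝ} (hU : 0 ≤ U) {a b : ℕ} (ha : 2 ≤ a) (hb : 2 ≤ b)
    {n : ℝ} (hn0 : 0 ≤ n) (hn2 : n < 2) {lo : ℝ} {c : ℕ} (hc : 0 < c)
    (h : ∀ L : ℕ, c ∣ L → a + b + 3 ≤ L → LTIRectSymGSNodeTW t U a b ((rectN n L : ℝ) / (L : ℝ) ^ 2) lo) :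
    lo ≤ energyDensity2D t U n := by
  have hck : Tendsto (fun k : ℕ => c * k) atTop atTop :=
    tendsto_atTop_atTop.2 fun N => ⟨N, fun k hk => hk.trans (Nat.le_mul_of_pos_left k hc)⟩
  refine ge_of_tendsto ((tendsto_energyDensity2D_torus t hU hn0 hn2).comp hck) ?_
  filter_upwards [eventually_ge_atTop (a + b + 3)] with k hk
  have hLk : a + b + 3 ≤ c * k := hk.trans (Nat.le_mul_of_pos_left k hc)
  haveI : NeZero (c * k) := ⟨by omega⟩
  rw [Function.comp_apply]
  have hnode := h (c * k) (dvd_mul_right c k) hLk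
  have hle : rectN n (c * k) ≤ 2 * (c * k) ^ 2 := by
    rw [sq]; exact rectN_le_two_mul hn0 hn2.le (c * k)
  exact hnode.le_groundEnergyAt_div t U (by omega) ha hb hLk hle

/-- The M3 cell of the term-wise symmetric node (`t = 1`, `U = 8`, `n = 7/8`; progression `L ∈ 4ℕ`). -/
theorem LTIRectSymGSNodeTW.m3EnergyLowerRow {a b : ℕ} (ha : 2 ≤ a) (hb : 2 ≤ b) {lo : ℚ}
    (h : LTIRectSymGSNodeTW 1 8 a b (7 / 8) lo) : M3EnergyLowerRow 0 lo := by
  refine (M3EnergyLowerRow_zero_iff lo).2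
    (LTIRectSymGSNodeTW.le_energyDensity2D 1 (by norm_num) ha hb (by norm_num) (by norm_num) (c := 4) (by norm_num)
      fun L hL h3 => ?_)
  obtain ⟨j, rfl⟩ := hL
  have hj : (0 : ℝ) < j := by exact_mod_cast (show 0 < j by omega)
  have e : ((rectN (7 / 8) (4 * j) : ℕ) : ℝ) / ((4 * j : ℕ) : ℝ) ^ 2 = 7 / 8 := by
    rw [rectN_seven_eighths]
    push_cast
    field_simp
    ring
  rw [e]
  exact h

/-- The M2 cell of the term-wise symmetric node (`t = 1`, half filling; progression `L ∈ 2ℕ`). -/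
theorem LTIRectSymGSNodeTW.m2EnergyLowerRow {U : ℝ} (hU : 0 ≤ U) {a b : ℕ} (ha : 2 ≤ a) (hb : 2 ≤ b) {lo : ℚ}
    (h : LTIRectSymGSNodeTW 1 U a b 1 lo) : M2EnergyLowerRow U lo := by
  refine LTIRectSymGSNodeTW.le_energyDensity2D 1 hU ha hb zero_le_one one_lt_two (c := 2) (by norm_num)
    fun L hL h3 => ?_
  obtain ⟨j, rfl⟩ := hL
  have hj : (0 : ℝ) < j := by exact_mod_cast (show 0 < j by omega)
  have e : ((rectN 1 (2 * j) : ℕ) : ℝ) / ((2 * j : ℕ) : ℝ) ^ 2 = 1 := by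
    rw [rectN_one]
    push_cast
    field_simp
    ring
  rw [e]
  exact h

end SymTL

end Summit.Ventures.CertifiedManyBodySolver.Rows.RectMarginalNodes

end
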